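import Mathlib
import Literature.Analysis.Convexity.AnisotropicPerimeterPolytopeLowerCutoff
import Literature.Analysis.Convexity.AnisotropicPerimeterPolytopeCutoffs
import HarnessLib

/-!
# The facet formula `P_K(P) = Σ_F h_K(ν_F)·area(F)` for compact convex H-polytopes in `ℝ³`

Topic `Literature/Analysis/Convexity`; namespace `Literature.Analysis.Convexity`.
Completion of the facet-formula programme (crystal3d-full eng MEMO-5/6, bricks L1–L4, T1, T2a–c):
for a compact H-polytope `P = {x | ∀ j ∈ J, Σ_l a_{jl} x_l ≤ b_j}` in `Fin 3 → ℝ` (read in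
`EuclideanSpace ℝ (Fin 3)` through `toLp`) with unit, pairwise non-proportional constraints, both
signs in every coordinate direction, isometric facet charts `Φ_j`, and a compact convex body `K ∋ 0`:
* `exists_facetCore` — inner regularity in a facet chart: a compact `C ⊆ {y | Φ_j y ∈ P, all other
  constraints strict}` carrying all but `ε` of the facet area (the non-strict part is a null union of
  tie lines, `volume_chartTieSet_eq_zero`);
* `facetSum_le_anisotropicPerimeter_hPolytope` — the LOWER half
  `Σ_j h_K(a_j)·area_j ≤ P_K(P)`: separated smooth cut-offs `χ_j ≡ 1` on the cores (disjoint closed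
  thickenings, `exists_contDiff_cutoff_Icc`), the field `Σ_j χ_j k_j` with `k_j ∈ K` maximising
  `⟪a_j, ·⟫` (`le_anisotropicPerimeter_hPolytope_of_cutoffs`), and `ε → 0`;
* `anisotropicPerimeter_hPolytope_eq_facetSum` — with the upper half
  (`anisotropicPerimeter_hPolytope_le_facetSum`): **`P_K(P) = Σ_j h_K(a_j)·area_j`**.
[cite: EvansGariepy2015, Thm 5.16 (Gauss–Green), polyhedral case; Maggi2012, (20.2) p. 258 and
Remark 20.3]
-/

noncomputable section

namespace Literature.Analysis.Convexity

open _root_.MeasureTheory Set Finset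
open scoped ENNReal NNReal
open Literature.MathematicalPhysics.StatisticalMechanics (fieldDivergence)
open Literature.MeasureTheory.Integral

variable {ι : Type*} [LinearOrder ι]

/-- **Facet cores.**  In the chart of facet `j`, for every `ε > 0` there is a compact set `C` of chart
points mapped into `P` with all OTHER constraints strict, whose measure is within `ε` of the facet
area `|{y | Φ_j y ∈ P}|`. [cite: EvansGariepy2015, Thm 5.16 (Gauss–Green), polyhedral case — plumbing] -/
theorem exists_facetCore {J : Finset ι} (a : ι → Fin 3 → ℝ) (b : ι → ℝ)
    (ha1 : ∀ j ∈ J, ∑ l, a j l ^ 2 = 1)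
    (hnd : ∀ j ∈ J, ∀ k ∈ J, j ≠ k → ¬ ∃ μ : ℝ, (∀ l, a k l = μ * a j l) ∧ b k = μ * b j)
    (p U V : ι → Fin 3 → ℝ) (hp : ∀ j ∈ J, ∑ l, a j l * p j l = b j)
    (hU : ∀ j ∈ J, ∑ l, a j l * U j l = 0) (hV : ∀ j ∈ J, ∑ l, a j l * V j l = 0)
    (hU1 : ∀ j ∈ J, ∑ l, U j l ^ 2 = 1) (hV1 : ∀ j ∈ J, ∑ l, V j l ^ 2 = 1)
    (hUV : ∀ j ∈ J, ∑ l, U j l * V j l = 0)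
    (hPc : IsCompact {x : Fin 3 → ℝ | ∀ j ∈ J, ∑ l, a j l * x l ≤ b j})
    {j : ι} (hj : j ∈ J) {ε : ℝ} (hε : 0 < ε) :
    ∃ C : Set (ℝ × ℝ), IsCompact C ∧
      (∀ y ∈ C, p j + y.1 • U j + y.2 • V j ∈ {x : Fin 3 → ℝ | ∀ j ∈ J, ∑ l, a j l * x l ≤ b j} ∧
        ∀ k ∈ J, k ≠ j → ∑ l, a k l * (p j + y.1 • U j + y.2 • V j) l < b k) ∧
      (volume {y : ℝ × ℝ | p j + y.1 • U j + y.2 • V j ∈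
          {x : Fin 3 → ℝ | ∀ j ∈ J, ∑ l, a j l * x l ≤ b j}}).toReal - ε ≤ (volume C).toReal := by
  classical
  set P : Set (Fin 3 → ℝ) := {x | ∀ j ∈ J, ∑ l, a j l * x l ≤ b j} with hP
  set Φ : ℝ × ℝ → (Fin 3 → ℝ) := fun y => p j + y.1 • U j + y.2 • V j with hΦ
  set S : Set (ℝ × ℝ) := {y | Φ y ∈ P} with hS
  set O : Set (ℝ × ℝ) := {y | ∀ k ∈ J, k ≠ j → ∑ l, a k l * Φ y l < b k} with hO
  have hΦc : Continuous Φ := by rw [hΦ]; fun_prop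
  have hplane : ∀ y, ∑ l, a j l * Φ y l = b j := by
    intro y
    have : ∀ l, a j l * Φ y l = a j l * p j l + y.1 * (a j l * U j l) + y.2 * (a j l * V j l) := by
      intro l; simp [hΦ, smul_eq_mul]; ring
    simp_rw [this, Finset.sum_add_distrib, ← Finset.mul_sum, hp j hj, hU j hj, hV j hj]; ring
  -- `S` compact, `O ⊆ S` open, `S \ O` null
  have hSclosed : IsClosed S := hPc.isClosed.preimage hΦc
  obtain ⟨R, hR⟩ : ∃ R, ∀ x ∈ P, ‖x‖ ≤ R := by
    obtain ⟨R, hR⟩ := hPc.isBounded.subset_closedBall 0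
    exact ⟨R, fun x hx => by simpa using hR hx⟩
  have hSbdd : Bornology.IsBounded S :=
    (Metric.isBounded_closedBall).subset
      (chartPreimage_subset_closedBall hR (p j) (U j) (V j) (hU1 j hj) (hV1 j hj) (hUV j hj))
  have hSfin : volume S < ⊤ := hSbdd.measure_lt_top
  have hOS : O ⊆ S := by
    intro y hy k hk
    by_cases hkj : k = j
    · subst hkj; exact (hplane y).le
    · exact (hy k hk hkj).le
  have hOopen : IsOpen O := by
    have : O = ⋂ k ∈ J.filter (fun k => k ≠ j), {y | ∑ l, a k l * Φ y l < b k} := by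
      ext y; simp [hO]
    rw [this]
    refine isOpen_biInter_finset fun k _ => ?_
    exact isOpen_lt (by fun_prop) continuous_const
  have hnull : volume (S \ O) = 0 := by
    have hcover : S \ O ⊆ ⋃ k ∈ J.filter (fun k => k ≠ j), {y | ∑ l, a k l * Φ y l = b k} := by
      intro y hy
      obtain ⟨hyS, hyO⟩ := hy
      simp only [hO, Set.mem_setOf_eq, not_forall, not_lt] at hyO
      obtain ⟨k, hk, hkj, hge⟩ := hyO
      refine Set.mem_biUnion (Finset.mem_filter.2 ⟨hk, hkj⟩) ?_
      exact le_antisymm (hyS k hk) hge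
    refine measure_mono_null hcover ?_
    refine (measure_biUnion_null_iff (J.filter (fun k => k ≠ j)).countable_toSet).2 fun k hk => ?_
    have hk' := Finset.mem_filter.1 hk
    exact volume_chartTieSet_eq_zero (a j) (a k) (p j) (U j) (V j) (b j) (b k) (ha1 j hj)
      (hnd j hj k hk'.1 (Ne.symm hk'.2)) (hp j hj) (hU j hj) (hV j hj) (hU1 j hj) (hV1 j hj) (hUV j hj)
  have hOvol : volume O = volume S := by
    refine le_antisymm (measure_mono hOS) ?_
    calc volume S ≤ volume (O ∪ (S \ O)) := measure_mono (fun y hy => by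
            by_cases h : y ∈ O; exact Or.inl h; exact Or.inr ⟨hy, h⟩)
      _ ≤ volume O + volume (S \ O) := measure_union_le _ _
      _ = volume O := by rw [hnull, add_zero]
  -- inner regularity
  have hOfin : volume O ≠ ⊤ := (lt_of_le_of_lt (measure_mono hOS) hSfin).ne
  obtain ⟨C, hCO, hCc, hCvol⟩ := hOopen.measurableSet.exists_isCompact_sdiff_lt hOfin
    (ENNReal.ofReal_pos.2 hε).ne'
  refine ⟨C, hCc, fun y hy => ⟨hOS (hCO hy), (hCO hy)⟩, ?_⟩
  -- `|S| − ε ≤ |C|`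
  have hCfin : volume C ≠ ⊤ := (lt_of_le_of_lt (measure_mono (hCO.trans hOS)) hSfin).ne
  have hsplit : volume O ≤ volume C + volume (O \ C) := by
    calc volume O ≤ volume (C ∪ (O \ C)) := measure_mono (fun y hy => by
            by_cases h : y ∈ C; exact Or.inl h; exact Or.inr ⟨hy, h⟩)
      _ ≤ volume C + volume (O \ C) := measure_union_le _ _
  have h1 : volume S ≤ volume C + ENNReal.ofReal ε := by
    rw [← hOvol]; exact hsplit.trans (add_le_add le_rfl hCvol.le)
  have h2 := ENNReal.toReal_mono (ENNReal.add_ne_top.2 ⟨hCfin, ENNReal.ofReal_ne_top⟩) h1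
  rw [ENNReal.toReal_add hCfin ENNReal.ofReal_ne_top, ENNReal.toReal_ofReal hε.le] at h2
  linarith

/-- **Separated facet cut-offs.**  For every `ε > 0` there are `C¹` compactly supported cut-offs
`χ_j : ℝ³ → [0,1]`, `Σ_j χ_j ≤ 1`, each vanishing on the other facets of `P`, with
`∫ 1_P(Φ_j y) χ_j(Φ_j y) dy ≥ area_j − ε`.
[cite: EvansGariepy2015, Thm 5.16 (Gauss–Green), polyhedral case — plumbing] -/
theorem exists_separatedCutoffs {J : Finset ι} (a : ι → Fin 3 → ℝ) (b : ι → ℝ)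
    (ha1 : ∀ j ∈ J, ∑ l, a j l ^ 2 = 1)
    (hnd : ∀ j ∈ J, ∀ k ∈ J, j ≠ k → ¬ ∃ μ : ℝ, (∀ l, a k l = μ * a j l) ∧ b k = μ * b j)
    (p U V : ι → Fin 3 → ℝ) (hp : ∀ j ∈ J, ∑ l, a j l * p j l = b j)
    (hU : ∀ j ∈ J, ∑ l, a j l * U j l = 0) (hV : ∀ j ∈ J, ∑ l, a j l * V j l = 0)
    (hU1 : ∀ j ∈ J, ∑ l, U j l ^ 2 = 1) (hV1 : ∀ j ∈ J, ∑ l, V j l ^ 2 = 1)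
    (hUV : ∀ j ∈ J, ∑ l, U j l * V j l = 0)
    (hPc : IsCompact {x : Fin 3 → ℝ | ∀ j ∈ J, ∑ l, a j l * x l ≤ b j}) {ε : ℝ} (hε : 0 < ε) :
    ∃ χ : ι → EuclideanSpace ℝ (Fin 3) → ℝ,
      (∀ j ∈ J, ContDiff ℝ 1 (χ j)) ∧ (∀ j ∈ J, HasCompactSupport (χ j)) ∧
      (∀ j ∈ J, ∀ x, 0 ≤ χ j x) ∧ (∀ x, ∑ j ∈ J, χ j x ≤ 1) ∧
      (∀ j ∈ J, ∀ k ∈ J, j ≠ k → ∀ x : Fin 3 → ℝ,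
        x ∈ {x : Fin 3 → ℝ | ∀ j ∈ J, ∑ l, a j l * x l ≤ b j} → ∑ l, a k l * x l = b k →
          χ j (WithLp.toLp 2 x) = 0) ∧
      (∀ j ∈ J, (volume {y : ℝ × ℝ | p j + y.1 • U j + y.2 • V j ∈
          {x : Fin 3 → ℝ | ∀ j ∈ J, ∑ l, a j l * x l ≤ b j}}).toReal - ε ≤
        ∫ y : ℝ × ℝ, {x : Fin 3 → ℝ | ∀ j ∈ J, ∑ l, a j l * x l ≤ b j}.indicator (fun _ => (1 : ℝ))
          (p j + y.1 • U j + y.2 • V j) * χ j (WithLp.toLp 2 (p j + y.1 • U j + y.2 • V j))) := by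
  classical
  set P : Set (Fin 3 → ℝ) := {x | ∀ j ∈ J, ∑ l, a j l * x l ≤ b j} with hP
  -- facet cores
  have hcore : ∀ j, j ∈ J → ∃ C : Set (ℝ × ℝ), IsCompact C ∧
      (∀ y ∈ C, p j + y.1 • U j + y.2 • V j ∈ P ∧
        ∀ k ∈ J, k ≠ j → ∑ l, a k l * (p j + y.1 • U j + y.2 • V j) l < b k) ∧
      (volume {y : ℝ × ℝ | p j + y.1 • U j + y.2 • V j ∈ P}).toReal - ε ≤ (volume C).toReal :=
    fun j hj => exists_facetCore a b ha1 hnd p U V hp hU hV hU1 hV1 hUV hPc hj hε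
  choose! C hCc hCin hCvol using hcore
  -- their images in `ℝ³`, the other facets, and separating thickenings
  set T : ι → Set (EuclideanSpace ℝ (Fin 3)) := fun j =>
    (fun y : ℝ × ℝ => (WithLp.toLp 2 (p j + y.1 • U j + y.2 • V j) : EuclideanSpace ℝ (Fin 3))) '' C j
    with hT
  set G : ι → Set (EuclideanSpace ℝ (Fin 3)) := fun j =>
    {z | (∀ m ∈ J, ∑ l, a m l * z l ≤ b m) ∧ ∃ k ∈ J, k ≠ j ∧ ∑ l, a k l * z l = b k} with hG
  have hΦc : ∀ j, Continuous fun y : ℝ × ℝ =>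
      (WithLp.toLp 2 (p j + y.1 • U j + y.2 • V j) : EuclideanSpace ℝ (Fin 3)) := by
    intro j; exact (PiLp.continuous_toLp 2 _).comp (by fun_prop)
  have hTc : ∀ j ∈ J, IsCompact (T j) := fun j hj => (hCc j hj).image (hΦc j)
  have hGclosed : ∀ j, IsClosed (G j) := by
    intro j
    have hlin : ∀ m, Continuous fun z : EuclideanSpace ℝ (Fin 3) => ∑ l, a m l * z l :=
      fun m => continuous_finsetSum _ fun l _ => continuous_const.mul (PiLp.continuous_apply 2 _ l)
    have h1 : IsClosed {z : EuclideanSpace ℝ (Fin 3) | ∀ m ∈ J, ∑ l, a m l * z l ≤ b m} := by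
      have : {z : EuclideanSpace ℝ (Fin 3) | ∀ m ∈ J, ∑ l, a m l * z l ≤ b m} =
          ⋂ m ∈ J, {z | ∑ l, a m l * z l ≤ b m} := by ext z; simp
      rw [this]
      exact isClosed_biInter fun m _ => isClosed_le (hlin m) continuous_const
    have h2 : IsClosed {z : EuclideanSpace ℝ (Fin 3) | ∃ k ∈ J, k ≠ j ∧ ∑ l, a k l * z l = b k} := by
      have : {z : EuclideanSpace ℝ (Fin 3) | ∃ k ∈ J, k ≠ j ∧ ∑ l, a k l * z l = b k} =
          ⋃ k ∈ J.filter (fun k => k ≠ j), {z | ∑ l, a k l * z l = b k} := by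
        ext z; simp [and_assoc]
      rw [this]
      exact isClosed_biUnion_finset fun k _ => isClosed_eq (hlin k) continuous_const
    simpa only [hG, Set.setOf_and] using h1.inter h2
  have hplane : ∀ j ∈ J, ∀ y : ℝ × ℝ, ∑ l, a j l * (p j + y.1 • U j + y.2 • V j) l = b j := by
    intro j hj y
    have : ∀ l, a j l * (p j + y.1 • U j + y.2 • V j) l =
        a j l * p j l + y.1 * (a j l * U j l) + y.2 * (a j l * V j l) := by
      intro l; simp [smul_eq_mul]; ring
    simp_rw [this, Finset.sum_add_distrib, ← Finset.mul_sum, hp j hj, hU j hj, hV j hj]; ring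
  have hTG : ∀ j ∈ J, Disjoint (T j) (G j) := by
    intro j hj
    rw [Set.disjoint_left]
    rintro _ ⟨y, hy, rfl⟩ ⟨-, k, hk, hkj, hEq⟩
    have hlt := (hCin j hj y hy).2 k hk hkj
    exact hlt.ne hEq
  have hTkG : ∀ j ∈ J, ∀ k ∈ J, k ≠ j → T k ⊆ G j := by
    intro j hj k hk hkj
    rintro _ ⟨y, hy, rfl⟩
    refine ⟨fun m hm => ?_, k, hk, hkj, ?_⟩
    · simpa only [PiLp.toLp_apply] using (hCin k hk y hy).1 m hm
    · simpa only [PiLp.toLp_apply] using hplane k hk y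
  have hδex : ∀ j, j ∈ J → ∃ δ : ℝ, 0 < δ ∧
      Disjoint (Metric.cthickening δ (T j)) (Metric.cthickening δ (G j)) :=
    fun j hj => (hTG j hj).exists_cthickenings (hTc j hj) (hGclosed j)
  choose! δ hδpos hδdisj using hδex
  -- the cut-offs
  have hχex : ∀ j, j ∈ J → ∃ χ : EuclideanSpace ℝ (Fin 3) → ℝ, ContDiff ℝ 1 χ ∧ HasCompactSupport χ ∧
      tsupport χ ⊆ Metric.thickening (δ j) (T j) ∧ (∀ x ∈ T j, χ x = 1) ∧ ∀ x, 0 ≤ χ x ∧ χ x ≤ 1 :=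
    fun j hj => exists_contDiff_cutoff_Icc (hTc j hj) Metric.isOpen_thickening
      (Metric.self_subset_thickening (hδpos j hj) _)
  choose! χ hχ1 hχc hχsupp hχT hχ01 using hχex
  have hsuppc : ∀ j ∈ J, tsupport (χ j) ⊆ Metric.cthickening (δ j) (T j) :=
    fun j hj => (hχsupp j hj).trans (Metric.thickening_subset_cthickening _ _)
  refine ⟨χ, hχ1, hχc, fun j hj x => (hχ01 j hj x).1, ?_, ?_, ?_⟩
  · -- `Σ_j χ_j ≤ 1`: the closed thickenings are pairwise disjoint
    intro x
    by_cases hex : ∃ j₀ ∈ J, χ j₀ x ≠ 0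
    · obtain ⟨j₀, hj₀, hne⟩ := hex
      have hx₀ : x ∈ Metric.cthickening (δ j₀) (T j₀) := hsuppc j₀ hj₀ (subset_tsupport _ hne)
      have hothers : ∀ k ∈ J, k ≠ j₀ → χ k x = 0 := by
        intro k hk hkj
        by_contra hne'
        have hxk : x ∈ Metric.cthickening (δ k) (T k) := hsuppc k hk (subset_tsupport _ hne')
        rcases le_total (δ k) (δ j₀) with hle | hle
        · have : x ∈ Metric.cthickening (δ j₀) (G j₀) :=
            Metric.cthickening_subset_of_subset _ (hTkG j₀ hj₀ k hk hkj)
              (Metric.cthickening_mono hle _ hxk)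
          exact Set.disjoint_left.1 (hδdisj j₀ hj₀) hx₀ this
        · have : x ∈ Metric.cthickening (δ k) (G k) :=
            Metric.cthickening_subset_of_subset _ (hTkG k hk j₀ hj₀ (Ne.symm hkj))
              (Metric.cthickening_mono hle _ hx₀)
          exact Set.disjoint_left.1 (hδdisj k hk) hxk this
      rw [Finset.sum_eq_single_of_mem j₀ hj₀ fun k hk hkj => hothers k hk hkj]
      exact (hχ01 j₀ hj₀ x).2
    · have h0 : ∀ j ∈ J, χ j x = 0 := fun j hj => by
        by_contra h; exact hex ⟨j, hj, h⟩
      rw [Finset.sum_eq_zero h0]; exact zero_le_one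
  · -- each `χ_j` vanishes on the other facets
    intro j hj k hk hjk x hx hEq
    have hxG : (WithLp.toLp 2 x : EuclideanSpace ℝ (Fin 3)) ∈ G j :=
      ⟨fun m hm => by simpa only [PiLp.toLp_apply] using hx m hm, k, hk, Ne.symm hjk,
        by simpa only [PiLp.toLp_apply] using hEq⟩
    have hxG' : (WithLp.toLp 2 x : EuclideanSpace ℝ (Fin 3)) ∈ Metric.cthickening (δ j) (G j) :=
      Metric.self_subset_cthickening _ hxG
    have hxT : (WithLp.toLp 2 x : EuclideanSpace ℝ (Fin 3)) ∉ tsupport (χ j) := fun h =>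
      Set.disjoint_left.1 (hδdisj j hj) (hsuppc j hj h) hxG'
    exact image_eq_zero_of_notMem_tsupport hxT
  · -- the area carried by `χ_j` is at least `|C_j| ≥ area_j − ε`
    intro j hj
    refine (hCvol j hj).trans ?_
    have hCmeas : MeasurableSet (C j) := (hCc j hj).isClosed.measurableSet
    have hCint : (volume (C j)).toReal = ∫ y : ℝ × ℝ, (C j).indicator (fun _ => (1 : ℝ)) y := by
      rw [integral_indicator_const _ hCmeas, smul_eq_mul, mul_one, measureReal_def]
    rw [hCint]
    -- integrability of the facet integrand (support in the compact chart preimage of `P`)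
    set S : Set (ℝ × ℝ) := {y | p j + y.1 • U j + y.2 • V j ∈ P} with hS
    have hSclosed : IsClosed S := hPc.isClosed.preimage (by fun_prop)
    obtain ⟨R, hR⟩ : ∃ R, ∀ x ∈ P, ‖x‖ ≤ R := by
      obtain ⟨R, hR⟩ := hPc.isBounded.subset_closedBall 0
      exact ⟨R, fun x hx => by simpa using hR hx⟩
    have hScpt : IsCompact S := Metric.isCompact_of_isClosed_isBounded hSclosed
      ((Metric.isBounded_closedBall).subset
        (chartPreimage_subset_closedBall hR (p j) (U j) (V j) (hU1 j hj) (hV1 j hj) (hUV j hj)))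
    have hint : Integrable (fun y : ℝ × ℝ => P.indicator (fun _ => (1 : ℝ)) (p j + y.1 • U j + y.2 • V j) *
        χ j (WithLp.toLp 2 (p j + y.1 • U j + y.2 • V j))) := by
      have hind : (fun y : ℝ × ℝ => P.indicator (fun _ => (1 : ℝ)) (p j + y.1 • U j + y.2 • V j) *
          χ j (WithLp.toLp 2 (p j + y.1 • U j + y.2 • V j))) =
          S.indicator (fun y => χ j (WithLp.toLp 2 (p j + y.1 • U j + y.2 • V j))) := by
        funext y
        by_cases hy : p j + y.1 • U j + y.2 • V j ∈ P
        · rw [Set.indicator_of_mem hy, Set.indicator_of_mem (show y ∈ S from hy), one_mul]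
        · rw [Set.indicator_of_notMem hy, Set.indicator_of_notMem (show y ∉ S from hy), zero_mul]
      rw [hind, integrable_indicator_iff hSclosed.measurableSet]
      exact (((hχ1 j hj).continuous).comp (hΦc j)).continuousOn.integrableOn_compact hScpt
    refine integral_mono ((integrable_indicator_iff hCmeas).2 (integrableOn_const
      ((lt_of_le_of_lt (measure_mono fun y hy => (hCin j hj y hy).1) hScpt.measure_lt_top)).ne))
      hint fun y => ?_
    beta_reduce
    by_cases hy : y ∈ C j
    · rw [Set.indicator_of_mem hy, Set.indicator_of_mem (hCin j hj y hy).1,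
        hχT j hj _ (Set.mem_image_of_mem _ hy)]
      simp
    · rw [Set.indicator_of_notMem hy]
      exact mul_nonneg (Set.indicator_nonneg (fun _ _ => zero_le_one) _) ((hχ01 j hj _).1)

/-- **Lower half of the facet formula.**  For a compact H-polytope as above and a compact convex
`K ∋ 0`: `Σ_j h_K(a_j)·area_j ≤ P_K(P)`.
[cite: EvansGariepy2015, Thm 5.16 (Gauss–Green), polyhedral case; Maggi2012, Remark 20.3] -/
theorem facetSum_le_anisotropicPerimeter_hPolytope {J : Finset ι}
    (a : ι → Fin 3 → ℝ) (b : ι → ℝ) (ha1 : ∀ j ∈ J, ∑ l, a j l ^ 2 = 1)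
    (hbd : ∀ i : Fin 3,
      (J.filter fun j => 0 < a j i).Nonempty ∧ (J.filter fun j => a j i < 0).Nonempty)
    (hnd : ∀ j ∈ J, ∀ k ∈ J, j ≠ k → ¬ ∃ μ : ℝ, (∀ l, a k l = μ * a j l) ∧ b k = μ * b j)
    (p U V : ι → Fin 3 → ℝ) (hp : ∀ j ∈ J, ∑ l, a j l * p j l = b j)
    (hU : ∀ j ∈ J, ∑ l, a j l * U j l = 0) (hV : ∀ j ∈ J, ∑ l, a j l * V j l = 0)
    (hU1 : ∀ j ∈ J, ∑ l, U j l ^ 2 = 1) (hV1 : ∀ j ∈ J, ∑ l, V j l ^ 2 = 1)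
    (hUV : ∀ j ∈ J, ∑ l, U j l * V j l = 0)
    (hPc : IsCompact {x : Fin 3 → ℝ | ∀ j ∈ J, ∑ l, a j l * x l ≤ b j})
    {K : Set (EuclideanSpace ℝ (Fin 3))} (hKc : IsCompact K) (hK : Convex ℝ K)
    (hK0 : (0 : EuclideanSpace ℝ (Fin 3)) ∈ K) :
    ENNReal.ofReal (∑ j ∈ J,
        sSup ((fun k : EuclideanSpace ℝ (Fin 3) => ∑ l, a j l * k l) '' K) *
          (volume {y : ℝ × ℝ | p j + y.1 • U j + y.2 • V j ∈
            {x : Fin 3 → ℝ | ∀ j ∈ J, ∑ l, a j l * x l ≤ b j}}).toReal) ≤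
      anisotropicPerimeter K {z : EuclideanSpace ℝ (Fin 3) | ∀ j ∈ J, ∑ l, a j l * z l ≤ b j} := by
  classical
  -- maximisers of `⟪a_j, ·⟫` on `K`
  have hlin : ∀ j, Continuous fun k : EuclideanSpace ℝ (Fin 3) => ∑ l, a j l * k l :=
    fun j => continuous_finsetSum _ fun l _ => continuous_const.mul (PiLp.continuous_apply 2 _ l)
  have hmax : ∀ j, ∃ kj ∈ K, IsMaxOn (fun k : EuclideanSpace ℝ (Fin 3) => ∑ l, a j l * k l) K kj :=
    fun j => hKc.exists_isMaxOn ⟨0, hK0⟩ (hlin j).continuousOn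
  choose kv hkvK hkvmax using hmax
  have hsup : ∀ j, sSup ((fun k : EuclideanSpace ℝ (Fin 3) => ∑ l, a j l * k l) '' K) =
      ∑ l, a j l * kv j l := by
    intro j
    refine IsGreatest.csSup_eq ⟨⟨kv j, hkvK j, rfl⟩, ?_⟩
    rintro _ ⟨k, hk, rfl⟩
    exact hkvmax j hk
  have hpos : ∀ j, 0 ≤ ∑ l, a j l * kv j l := fun j => by
    have := hkvmax j hK0; simpa using this
  simp_rw [hsup]
  set vol : ι → ℝ := fun j => (volume {y : ℝ × ℝ | p j + y.1 • U j + y.2 • V j ∈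
    {x : Fin 3 → ℝ | ∀ j ∈ J, ∑ l, a j l * x l ≤ b j}}).toReal with hvol
  set M : ℝ := ∑ j ∈ J, ∑ l, a j l * kv j l with hM
  have hM0 : 0 ≤ M := Finset.sum_nonneg fun j _ => hpos j
  refine ENNReal.le_of_forall_pos_le_add fun ε hε _ => ?_
  have hε' : 0 < (ε : ℝ) / (M + 1) := div_pos (by exact_mod_cast hε) (by linarith)
  obtain ⟨χ, hχ1, hχc, hχ0, hχs, hsep, harea⟩ :=
    exists_separatedCutoffs a b ha1 hnd p U V hp hU hV hU1 hV1 hUV hPc hε'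
  have hlow := le_anisotropicPerimeter_hPolytope_of_cutoffs a b ha1 hbd hnd p U V hp hU hV hU1 hV1
    hUV hPc hK hK0 kv (fun j _ => hkvK j) χ hχ1 hχc hχ0 hχs hsep
  -- `Σ f_j vol_j ≤ Σ f_j I_j + ε`
  have hcmp : ∑ j ∈ J, (∑ l, a j l * kv j l) * vol j ≤
      (∑ j ∈ J, (∑ l, a j l * kv j l) *
        (∫ y : ℝ × ℝ, {x : Fin 3 → ℝ | ∀ j ∈ J, ∑ l, a j l * x l ≤ b j}.indicator (fun _ => (1 : ℝ))
          (p j + y.1 • U j + y.2 • V j) * χ j (WithLp.toLp 2 (p j + y.1 • U j + y.2 • V j)))) + ε := by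
    have h1 : ∀ j ∈ J, (∑ l, a j l * kv j l) * vol j ≤ (∑ l, a j l * kv j l) *
        (∫ y : ℝ × ℝ, {x : Fin 3 → ℝ | ∀ j ∈ J, ∑ l, a j l * x l ≤ b j}.indicator (fun _ => (1 : ℝ))
          (p j + y.1 • U j + y.2 • V j) * χ j (WithLp.toLp 2 (p j + y.1 • U j + y.2 • V j))) +
        (∑ l, a j l * kv j l) * ((ε : ℝ) / (M + 1)) := by
      intro j hj
      have := harea j hj
      nlinarith [hpos j]
    have h2 := Finset.sum_le_sum h1
    rw [Finset.sum_add_distrib, ← Finset.sum_mul] at h2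
    have h3 : M * ((ε : ℝ) / (M + 1)) ≤ ε := by
      rw [mul_div_assoc']
      rw [div_le_iff₀ (by linarith)]
      nlinarith [hε.le, hM0, (show (0:ℝ) ≤ ε from by exact_mod_cast hε.le)]
    linarith
  calc ENNReal.ofReal (∑ j ∈ J, (∑ l, a j l * kv j l) * vol j)
      ≤ ENNReal.ofReal ((∑ j ∈ J, (∑ l, a j l * kv j l) *
          (∫ y : ℝ × ℝ, {x : Fin 3 → ℝ | ∀ j ∈ J, ∑ l, a j l * x l ≤ b j}.indicator (fun _ => (1 : ℝ))
            (p j + y.1 • U j + y.2 • V j) * χ j (WithLp.toLp 2 (p j + y.1 • U j + y.2 • V j)))) + ε) :=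
        ENNReal.ofReal_le_ofReal hcmp
    _ ≤ ENNReal.ofReal (∑ j ∈ J, (∑ l, a j l * kv j l) *
          (∫ y : ℝ × ℝ, {x : Fin 3 → ℝ | ∀ j ∈ J, ∑ l, a j l * x l ≤ b j}.indicator (fun _ => (1 : ℝ))
            (p j + y.1 • U j + y.2 • V j) * χ j (WithLp.toLp 2 (p j + y.1 • U j + y.2 • V j)))) +
          ENNReal.ofReal ε := ENNReal.ofReal_add_le
    _ ≤ anisotropicPerimeter K {z : EuclideanSpace ℝ (Fin 3) | ∀ j ∈ J, ∑ l, a j l * z l ≤ b j} + ε := by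
        rw [ENNReal.ofReal_coe_nnreal]; exact add_le_add hlow le_rfl

/-- **The facet formula for the anisotropic perimeter of a compact convex polytope in `ℝ³`:**
`P_K(P) = Σ_j h_K(a_j)·area_j` (compact convex `K ∋ 0`; `h_K(a_j) = max_K ⟪a_j, ·⟫`, `area_j` = the
area of the `j`-th facet read in its isometric chart).
[cite: EvansGariepy2015, Thm 5.16 (Gauss–Green), polyhedral case; Maggi2012, (20.2) p. 258, Remark 20.3] -/
theorem anisotropicPerimeter_hPolytope_eq_facetSum {J : Finset ι}
    (a : ι → Fin 3 → ℝ) (b : ι → ℝ) (ha1 : ∀ j ∈ J, ∑ l, a j l ^ 2 = 1)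
    (hbd : ∀ i : Fin 3,
      (J.filter fun j => 0 < a j i).Nonempty ∧ (J.filter fun j => a j i < 0).Nonempty)
    (hnd : ∀ j ∈ J, ∀ k ∈ J, j ≠ k → ¬ ∃ μ : ℝ, (∀ l, a k l = μ * a j l) ∧ b k = μ * b j)
    (p U V : ι → Fin 3 → ℝ) (hp : ∀ j ∈ J, ∑ l, a j l * p j l = b j)
    (hU : ∀ j ∈ J, ∑ l, a j l * U j l = 0) (hV : ∀ j ∈ J, ∑ l, a j l * V j l = 0)
    (hU1 : ∀ j ∈ J, ∑ l, U j l ^ 2 = 1) (hV1 : ∀ j ∈ J, ∑ l, V j l ^ 2 = 1)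
    (hUV : ∀ j ∈ J, ∑ l, U j l * V j l = 0)
    (hPc : IsCompact {x : Fin 3 → ℝ | ∀ j ∈ J, ∑ l, a j l * x l ≤ b j})
    {K : Set (EuclideanSpace ℝ (Fin 3))} (hKc : IsCompact K) (hK : Convex ℝ K)
    (hK0 : (0 : EuclideanSpace ℝ (Fin 3)) ∈ K) :
    anisotropicPerimeter K {z : EuclideanSpace ℝ (Fin 3) | ∀ j ∈ J, ∑ l, a j l * z l ≤ b j} =
      ENNReal.ofReal (∑ j ∈ J,
        sSup ((fun k : EuclideanSpace ℝ (Fin 3) => ∑ l, a j l * k l) '' K) *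
          (volume {y : ℝ × ℝ | p j + y.1 • U j + y.2 • V j ∈
            {x : Fin 3 → ℝ | ∀ j ∈ J, ∑ l, a j l * x l ≤ b j}}).toReal) :=
  le_antisymm
    (anisotropicPerimeter_hPolytope_le_facetSum a b ha1 hbd hnd p U V hp hU hV hU1 hV1 hUV hPc hKc)
    (facetSum_le_anisotropicPerimeter_hPolytope a b ha1 hbd hnd p U V hp hU hV hU1 hV1 hUV hPc hKc
      hK hK0)

end Literature.Analysis.Convexity

end
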